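import Literature.AlgebraicGeometry.AbelianSchemes.AbelianSchemeOverSectionPow
import Literature.AlgebraicGeometry.AbelianSchemes.AbelianSchemeOverSectionsBaseChange
import HarnessLib

/-!
# The level change `σ ↦ σ^d` of a level structure on an abelian scheme
# ([MumfordFogartyKirwan1994, App. 7A]; cell hodgecm-mathlib, M1PRIME-DAG rung 0, W2 (c1)–(c4) `LevelStructure.changeLevel`)

[MumfordFogartyKirwan1994, App. 7A (p. 235)] takes the moduli schemes `𝒜_{g,δ,n}` «as a tower with respect to finite
morphisms `𝒜_{nm} → 𝒜_n`»: a level-`nm` structure `σ₁, …, σ_{2g}` (Def. 7.1: `2g` sections whose images at every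
geometric point `s` form a basis of the points of order `nm` on `X̄_s`) is sent to the level-`n` structure `(m σᵢ)`
(multiplicatively: `σᵢ ^ m`); [Deligne1971TravauxShimura, 1.8 (p. 129)] «pour `K' ⊂ K` … l'application évidente»,
4.16 (p. 150) the principal levels `K(n)`.  That `(σᵢ ^ d)` IS again a level structure (a basis of `X_s[N'](Ω)` at every
geometric point, `N = N' d`) is the content here: injectivity by the exponent lift `(ℤ/N')^{2g} ↪ (ℤ/N)^{2g}`,
`a ↦ d·a`; surjectivity because `b ↦ σ^b(s)` is a homomorphism on the COMMUTATIVE `X_s(Ω)` — read fibrewise through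
`restrictPt` and ★ `Motives.AbelianVariety.Points.instCommGroup` ([MumfordFogartyKirwan1994] Cor. 6.5 at field level),
which is ★ `AbelianSchemeOver.basis_injective_pow` / `basis_surjective_pow` (`AbelianSchemeOverSectionPow`).  No global
commutativity of the group of sections is used (`pow_σ` only needs that powers of ONE section commute).

## Main definitions and results
* `AbelianSchemeOver.LevelStructure.changeLevel φ N' d (hd : N = N' * d) (hN : N ≠ 0)` — the level-`N'` structure
  `(σᵢ ^ d)` of a level-`N` structure `φ = (σᵢ)` (cofactor form).
* `changeLevel_σ` — its sections are the `d`-th powers (by construction).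
* `changeLevel_self` — along `N = N · d` (`d = 1`) it is the identity (gives `Nm.map (𝟙 K) = 𝟙`).
* `changeLevel_changeLevel` — transitivity `N → N' → N''` (gives `Nm.map (f ≫ f') = Nm.map f ≫ Nm.map f'`).
* `LevelStructure.IsBaseChangeVia.changeLevel` — naturality for the pull-back relation of [MumfordFogartyKirwan1994,
  Def. 7.3] (★ `AbelianSchemeOverSectionsBaseChange`, `σ_pow_comp`): the level-lowering map is a natural
  transformation of the moduli functors.
* `LevelStructure.ext_σ` — a level structure is determined by its basis sections.

Cell hodgecm-mathlib, #60 Mumford line, rung 0 (director s91 (2): additive D1-adjacent module, never an edition of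
★ `AbelianSchemeOverBase`); B-plan1 P30; prover seat B-p09.  HC_CM is proved only modulo the 7 printed citations until
rung 0 closes; this file discharges none of them.

## References
* [MumfordFogartyKirwan1994] D. Mumford, J. Fogarty, F. Kirwan, *Geometric Invariant Theory*, 3rd ed. (1994), Ch. 7 §2
  Def. 7.1 and Def. 7.3 (p. 129), App. 7A (pp. 235–236).
* [Deligne1971TravauxShimura] P. Deligne, *Travaux de Shimura*, Sém. Bourbaki 389 (1971), 1.8 (p. 129), 4.16 (p. 150).
* Tree: ★ `AbelianSchemes.AbelianSchemeOverBase` (`LevelStructure`, `sectionPow`, `IsBaseChangeVia`),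
  ★ `AbelianSchemeOverRestrictPt`, ★ `AbelianSchemeOverSectionPow` (`basis_injective_pow`, `basis_surjective_pow`),
  ★ `AbelianSchemeOverSectionsBaseChange` (`LevelStructure.IsBaseChangeVia.σ_pow_comp`).
-/

universe u

open CategoryTheory CategoryTheory.Limits AlgebraicGeometry MonoidalCategory

noncomputable section

namespace Literature.AlgebraicGeometry.AbelianSchemes

namespace AbelianSchemeOver

open scoped MonObj

namespace LevelStructure

variable {S : Scheme.{u}} {A : AbelianSchemeOver S} {g N : ℕ} (φ : A.LevelStructure g N)

/-- A level structure is determined by its basis sections (the other fields are propositions).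
[cite: MumfordFogartyKirwan1994, Ch. 7 §2 Definition 7.1 (p. 129)] -/
theorem ext_σ {φ ψ : A.LevelStructure g N} (h : φ.σ = ψ.σ) : φ = ψ := by
  cases φ; cases ψ; cases h; rfl

/-- **THE LEVEL CHANGE `changeLevel`** ([MumfordFogartyKirwan1994, App. 7A] tower `𝒜_{g,δ,N} → 𝒜_{g,δ,N'}`,
[Deligne1971TravauxShimura, 1.8 / 4.16] «l'application évidente» for `K(N) ⊂ K(N')`): for `N = N' · d` (COFACTOR
form) the level-`N` structure `(σᵢ)` yields the level-`N'` structure `(σᵢ ^ d)`.  `pow_σ` is global and free (powers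
of one section commute); the basis property at every geometric point (MFK Def. 7.1 (i)) is ★
`basis_injective_pow` / `basis_surjective_pow` (fibrewise, in the commutative `X_s(Ω)`).
[cite: MumfordFogartyKirwan1994, Ch. 7 §2 Definition 7.1 (p. 129) and App. 7A (p. 235)] [cite: Deligne1971TravauxShimura, 1.8 p. 129, 4.16 p. 150] -/
def changeLevel (N' d : ℕ) (hd : N = N' * d) (hN : N ≠ 0) : A.LevelStructure g N' where
  σ k := φ.σ k ^ d
  pow_σ k := by
    rw [← pow_mul, Nat.mul_comm d N', ← hd]
    exact φ.pow_σ k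
  basis_injective Ω _ _ s :=
    haveI : NeZero N := ⟨hN⟩
    A.basis_injective_pow s φ.σ φ.pow_σ d hd (φ.basis_injective s)
  basis_surjective Ω _ _ s x hx :=
    haveI : NeZero N := ⟨hN⟩
    A.basis_surjective_pow s φ.σ φ.pow_σ d hd (φ.basis_injective s) (φ.basis_surjective s) x hx

/-- The basis sections of `changeLevel` are the `d`-th powers (by construction).
[cite: MumfordFogartyKirwan1994, App. 7A (p. 235)] -/
@[simp] theorem changeLevel_σ (N' d : ℕ) (hd : N = N' * d) (hN : N ≠ 0) (k : Fin g ⊕ Fin g) :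
    (φ.changeLevel N' d hd hN).σ k = φ.σ k ^ d := rfl

/-- **`changeLevel` along `N = N · d` (so `d = 1`) is the identity** — the source of `Nm.map (𝟙 K) = 𝟙` for the Siegel
tower. [cite: Deligne1971TravauxShimura, 1.8 p. 129] -/
theorem changeLevel_self (d : ℕ) (hd : N = N * d) (hN : N ≠ 0) : φ.changeLevel N d hd hN = φ := by
  have hd1 : d = 1 := by
    have h : N * d = N * 1 := by rw [mul_one]; exact hd.symm
    exact Nat.eq_of_mul_eq_mul_left (Nat.pos_of_ne_zero hN) h
  subst hd1
  exact ext_σ (funext fun k => by rw [changeLevel_σ, pow_one])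

/-- **`changeLevel` is transitive**: changing `N → N' → N''` equals changing `N → N''` (with ANY cofactor witnesses) — the
source of `Nm.map (f ≫ f') = Nm.map f ≫ Nm.map f'`. [cite: Deligne1971TravauxShimura, 1.8 p. 129] -/
theorem changeLevel_changeLevel (N' d₁ : ℕ) (h₁ : N = N' * d₁) (hN : N ≠ 0) (N'' d₂ : ℕ) (h₂ : N' = N'' * d₂)
    (hN' : N' ≠ 0) (d₃ : ℕ) (h₃ : N = N'' * d₃) :
    (φ.changeLevel N' d₁ h₁ hN).changeLevel N'' d₂ h₂ hN' = φ.changeLevel N'' d₃ h₃ hN := by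
  have hN'' : N'' ≠ 0 := by rintro rfl; exact hN' (by rw [h₂, zero_mul])
  have hd₃ : d₃ = d₁ * d₂ := by
    have h : N'' * d₃ = N'' * (d₁ * d₂) := by rw [← h₃, h₁, h₂]; ring
    exact Nat.eq_of_mul_eq_mul_left (Nat.pos_of_ne_zero hN'') h
  subst hd₃
  exact ext_σ (funext fun k => by rw [changeLevel_σ, changeLevel_σ, changeLevel_σ, ← pow_mul])

/-- **NATURALITY of the level change for the pull-back relation** ([MumfordFogartyKirwan1994, Def. 7.3]): if `(G, f)`
identifies the level structure `φ'` on `A'/S'` with the pull-back of `φ` on `A/S`, it identifies `φ'.changeLevel`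
with the pull-back of `φ.changeLevel` — ★ `LevelStructure.IsBaseChangeVia.σ_pow_comp` packaged; so App. 7A's
level-lowering `𝒜_{g,δ,N} → 𝒜_{g,δ,N'}` is a natural transformation of the moduli functors.
[cite: MumfordFogartyKirwan1994, Ch. 7 §2 Definition 7.3 (p. 129) and App. 7A (p. 235)] -/
theorem IsBaseChangeVia.changeLevel {S' : Scheme.{u}} {A' : AbelianSchemeOver S'} {φ' : A'.LevelStructure g N}
    {f : S' ⟶ S} {G : A'.X.left ⟶ A.X.left} (h : φ'.IsBaseChangeVia φ f G)
    (N' d : ℕ) (hd : N = N' * d) (hN : N ≠ 0) :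
    (φ'.changeLevel N' d hd hN).IsBaseChangeVia (φ.changeLevel N' d hd hN) f G :=
  ⟨h.1, fun i => h.σ_pow_comp d i⟩

end LevelStructure

end AbelianSchemeOver

end Literature.AlgebraicGeometry.AbelianSchemes

end
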